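import Summits.RiemannHypothesis.RiemannHypothesis.Theorems.SoninPolyFrame050Data
import HarnessLib

/-!
# The `b = 1/2` four-vector Sonin-section certificate for `S = {∞, 2}`, II: the twisted-trace kernel checks

Cell `rh-explicit`, seat cc-s2-1 (lead R7-33 GO).  Five Boolean certificates evaluated by the kernel (`decide +kernel`,
no `native_decide`): the antiderivative table `antiderivsOK 75 (kappaL pH (1/2))` (`SoninPolyTraceBound`), and for each section vector `η_i = polyEta (rH i) 12` the twisted-trace check
`checkTraceB pH (1/2) (rH i) 12 prmB 5 15 (BH i)` of `SoninPolyTraceCheck` (interval evaluation, at scale `2^400`, of the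
closed form of `⟨η_i | ϑ(T₂(G⋆G̃)) η_i⟩` from `SoninPolyTrace*`: integer antiderivative recurrence, integer Horner at
`zΛ`, six `exp` enclosures, 15 chunks of 5 indices), which with `qtabCheck` gives
`B_i ≤ Re ⟨η_i | ϑ(T₂(G⋆G̃)) η_i⟩` (file III).  Measured kernel time ≈ 40–60 s per vector on the farm.  No facts, no axioms.
-/

set_option linter.dupNamespace false  -- the mandated namespace repeats `RiemannHypothesis`

noncomputable section

open Summit.RiemannHypothesis.RiemannHypothesis.Theorems.SemilocalPolyWitness
open Summit.RiemannHypothesis.RiemannHypothesis.SoninCert (derivL)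
open Summit.RiemannHypothesis.RiemannHypothesis.SoninPoly
open Literature.Analysis.ValidatedNumerics Literature.Analysis.ValidatedNumerics.NumericsMP

namespace Summit.RiemannHypothesis.RiemannHypothesis.SoninPoly.Frame050

set_option maxHeartbeats 0 in  -- kernel evaluation of the rational certificate; no search
set_option maxRecDepth 200000 in
/-- The certificate antiderivatives `Q_{±(2k+1)}`, `k < 75`, of `κ = kappaL pH (1/2)` pass their ODE checks
(`(z/2)Q + Q′ = κ` coefficientwise; hypothesis `hQ` of `re_soninTraceForm_polyEta_ge_of_check`; ≈ 30 s). [folklore] -/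
theorem qtabCheck : antiderivsOK (15 * 5) (kappaL pH (1 / 2)) = true := by
  decide +kernel

set_option maxHeartbeats 0 in  -- kernel evaluation of the rational certificate; no search
set_option maxRecDepth 200000 in
/-- Twisted-trace certificate for `η_1`: `B_1 ≤ Re ⟨η_1 | ϑ(T₂(G⋆G̃)) η_1⟩` once decoded by
`re_soninTraceForm_polyEta_ge_of_check`. [folklore] -/
theorem traceCheck0 : checkTraceB pH (1 / 2) rH0 12 prmB 5 15 (BH 0) = true := by
  decide +kernel

set_option maxHeartbeats 0 in  -- kernel evaluation of the rational certificate; no search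
set_option maxRecDepth 200000 in
/-- Twisted-trace certificate for `η_2`: `B_2 ≤ Re ⟨η_2 | ϑ(T₂(G⋆G̃)) η_2⟩` once decoded by
`re_soninTraceForm_polyEta_ge_of_check`. [folklore] -/
theorem traceCheck1 : checkTraceB pH (1 / 2) rH1 12 prmB 5 15 (BH 1) = true := by
  decide +kernel

set_option maxHeartbeats 0 in  -- kernel evaluation of the rational certificate; no search
set_option maxRecDepth 200000 in
/-- Twisted-trace certificate for `η_3`: `B_3 ≤ Re ⟨η_3 | ϑ(T₂(G⋆G̃)) η_3⟩` once decoded by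
`re_soninTraceForm_polyEta_ge_of_check`. [folklore] -/
theorem traceCheck2 : checkTraceB pH (1 / 2) rH2 12 prmB 5 15 (BH 2) = true := by
  decide +kernel

set_option maxHeartbeats 0 in  -- kernel evaluation of the rational certificate; no search
set_option maxRecDepth 200000 in
/-- Twisted-trace certificate for `η_4`: `B_4 ≤ Re ⟨η_4 | ϑ(T₂(G⋆G̃)) η_4⟩` once decoded by
`re_soninTraceForm_polyEta_ge_of_check`. [folklore] -/
theorem traceCheck3 : checkTraceB pH (1 / 2) rH3 12 prmB 5 15 (BH 3) = true := by
  decide +kernel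

end Summit.RiemannHypothesis.RiemannHypothesis.SoninPoly.Frame050

end
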